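import Summits.BirchSwinnertonDyer.BirchSwinnertonDyer.Theorems.EdixhovenFibreFiveSevenTwistDegreeStepOrdinaryOfReciprocityLaw
import Summits.BirchSwinnertonDyer.BirchSwinnertonDyer.Theorems.EdixhovenFibreFiveSevenRecTowerOrdinaryUnstarredAnyPrime
import Summits.BirchSwinnertonDyer.BirchSwinnertonDyer.Theorems.EdixhovenFibreFiveSevenStarredOptimalManinUnitFiveSevenCellsOfRecTowerAtIntrinsicAlt
import Summits.BirchSwinnertonDyer.BirchSwinnertonDyer.Theorems.ManinLocalTwoThreeManinPrimeToAdditiveFiveLeIsogenyMinimalDiscriminantRigidity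
import Summits.BirchSwinnertonDyer.Rank1Residual.Additive.GordIsogenyInvariance
import HarnessLib

/-!
# Crux TDS11 `TwistDegreeStepOrdinary` (stmt-BirchSwinnertonDyer-22228) BY NAME, GRANTED ONLY P1-bar — Kato's explicit reciprocity law [REC-tower] ELIMINATED
# (route `EdixhovenFibreFiveSeven`, line `kato-lever`; seat `bsd-line-edix-p1` g33, LEAD)

HONEST FRAMING. ONE conditional theorem (no definition, no named fact, no instance, no `sorry`; file-local instance keys on `ℚ_v` byte-identical to
`…CellsOfRecTowerAtIntrinsicAlt` l.73–77); helper `--supports` 22228. Nothing is closed: TDS11 stays OPEN ⟸ P1-bar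
(`Literature.NumberTheory.EllipticCurves.Kato2004.exists_member_sl2ZetaElement_neron_values_bar`, print XL); BSD is not proved by any of this.

WHAT. The closer of record `…TwistDegreeStepOrdinaryOfReciprocityLaw.twistDegreeStepOrdinary_of_reciprocityLaw_of_sl2NeronValuesBar : [REC-tower] → P1-bar → TDS11`
(g18) read the ∀-fields cite fact [REC-tower] (`tatePairingPoint_eq_trace_expStar_log_tower`, Kato LNM 1553 II Thm. 1.4.1 (4)) through hT₂. Here hT₂ is REPLACED by the
tree THEOREM `RecTowerOrdinaryUnstarredAnyPrime.recTowerOrdinaryUnstarred_of_typeGOrd` (this seat): [REC-tower] at every cyclotomic tower for every globally minimal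
(G)-ORDINARY additive curve with `ord_p Δ_min ≤ 4` at any `p ≥ 5` — which is exactly the locus of the members `W′ ∼ W₀ ∼ V` of TDS11's frame (`TypeGOrd`, `Addv`,
`ord_p Δ_min` transported along the prime-free isogeny lemmas `TypeGOrd.of_isIsogenous`, `X2.addv_iff_of_isIsogenous`,
`padicValInt_minimalDiscriminantInt_eq_of_isIsogenous_of_typeGOrd`). Proof = the g18 proof VERBATIM with the socket
`katoNeronBody_of_sl2NeronValuesBar_of_isDeRhamAt hT₂` replaced by `…AssemblyAtBarOfRangeAt.katoNeronBody_of_sl2NeronValuesBar_of_rangeAt`, whose per-member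
range hypothesis `hT₂V` is `…RecTowerAtBridgeAlt.rangeAt_of_recTowerAtAlt ∘ recTowerOrdinaryUnstarred_of_typeGOrd`.

* ★★★ `twistDegreeStepOrdinary_of_sl2NeronValuesBar : P1-bar → TwistDegreeStepOrdinary`.

So TDS11's ONLY printed input is P1-bar (Kato 2004 (8.1.3)/Thm. 9.7/Thm. 6.6 (1)/Thm. 13.6 in the Néron coordinate) — the same as K★ (22226). CONDITIONAL; OPEN.

References: [Kato2004Asterisque] Thm. 6.6 (1), (8.1.3), Thm. 9.7; [Kato1993LNM1553] Ch. II Thm. 1.4.1 (3)–(4), Ex. 1.3.5 (the statement being re-proved on this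
locus); [EdixhovenManin1991] §4; [Serre1972] §5.6; [BrinonConrad2009] Prop. 6.3.8.
-/

set_option autoImplicit false
-- the Theorems namespace of a single-conjunct summit repeats the summit name by design (D-0017)
set_option linter.dupNamespace false

noncomputable section

open scoped Classical MatrixGroups NumberField NNReal

open WeierstrassCurve NumberField IsDedekindDomain Field ValuativeRel
  Literature.NumberTheory.EllipticCurves Literature.NumberTheory.EllipticCurves.ModularForms
  Literature.NumberTheory.EllipticCurves.Rank1Residual Literature.NumberTheory.EllipticCurves.Kato2004
  Literature.NumberTheory.DiophantineGeometry Rat.HeightOneSpectrum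
  Literature.NumberTheory.PAdicHodge Literature.NumberTheory.GaloisRepresentations
  Literature.NumberTheory.GaloisRepresentations.IsNonarchimedeanLocalField
  Literature.NumberTheory.GaloisRepresentations.PeriodRingData
  Summit.BirchSwinnertonDyer.Rank1Residual Summit.BirchSwinnertonDyer.Rank1Residual.Additive
  Summit.BirchSwinnertonDyer.Rank1Residual.GaloisImage
  Summit.BirchSwinnertonDyer.BirchSwinnertonDyer.Theorems
  Summit.BirchSwinnertonDyer.BirchSwinnertonDyer.Theorems.KatoAssemblySocketAt
  Summit.BirchSwinnertonDyer.BirchSwinnertonDyer.Theorems.ManinFrameResidueProperRTameTwistAt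
  Summit.BirchSwinnertonDyer.BirchSwinnertonDyer.Theorems.TwistDegreeStepOrdinaryOfSL2NeronValues
  Summit.BirchSwinnertonDyer.BirchSwinnertonDyer.Theorems.StarredOptimalManinUnitFiveSevenAssemblyAtBarOfRangeAt
  Summit.BirchSwinnertonDyer.BirchSwinnertonDyer.Theorems.RecTowerOrdinaryUnstarredAnyPrime
  Summit.BirchSwinnertonDyer.BirchSwinnertonDyer.Theorems.KimAtThreeDeepLowerExpStarOmega
  Summit.BirchSwinnertonDyer.BirchSwinnertonDyer.Theorems.KimAtThreeDeepLowerExpStarOmegaPlace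
  CongruenceSubgroup Complex
open Summit.BirchSwinnertonDyer.BirchSwinnertonDyer.Theorems.KimAtThreeDeepUpperTowerLattice (fact_natCast_mem_primesEquiv_symm)

namespace Summit.BirchSwinnertonDyer.BirchSwinnertonDyer.Theorems.TwistDegreeStepOrdinaryOfSL2NeronValuesBar

-- FILE-LOCAL instance keys, byte-identical to the accepted `…CellsOfRecTowerAtIntrinsicAlt.lean` l.73–77 (no library instance is
-- overridden outside this file): the `Fact (p ∈ v_p)` key and the local-field structures on `ℚ_v = Place.Completion (inr v)`.
attribute [local instance] fact_natCast_mem_primesEquiv_symm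
attribute [local instance 100000] NumberField.Place.instAlgebraCompletion
attribute [local instance] valuativeRelPlace topologicalSpacePlace
attribute [local instance] isNonarchimedeanLocalField_place charZero_place
attribute [local instance] padicAlgebraPlace fact_not_isUnit_place isAdicComplete_place

/-- ★★★ **TDS11 `TwistDegreeStepOrdinary` GRANTED ONLY P1-bar** — the proof of `twistDegreeStepOrdinary_of_expStarTower_of_sl2NeronValuesBar` verbatim with the
opener `katoNeronBody_of_sl2NeronValuesBar_of_rangeAt`, whose per-member (S5b-tower) hypothesis is DISCHARGED by the tree theorem [REC-tower] at the (G)-ordinary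
unstarred cells (`recTowerOrdinaryUnstarred_of_typeGOrd`, any `p ≥ 5`) through the bridge `rangeAt_of_recTowerAtAlt`; the members `W′ ∼ W₀ ∼ V` inherit `Addv`,
`TypeGOrd` and `ord_p Δ_min ≤ 4` (`X2.addv_iff_of_isIsogenous`, `TypeGOrd.of_isIsogenous`, `padicValInt_minimalDiscriminantInt_eq_of_isIsogenous_of_typeGOrd`); hDR at `W₀`
from `isDeRham_restrictedRationalTateRep_adicCompletion_rat_of_typeGOrd` at `V`, moved along the isogeny. CONDITIONAL on P1-bar; the item is not closed.
[cite: Kato2004Asterisque, Thm. 6.6 (1) (p. 163), (8.1.3) (p. 180), Thm. 9.7 (p. 189)] [cite: EdixhovenManin1991, §4]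
[cite: Kato1993LNM1553, Ch. II Thm. 1.4.1 (3)–(4) and Ex. 1.3.5] [cite: Serre1972, §5.6] -/
theorem twistDegreeStepOrdinary_of_sl2NeronValuesBar (hP1 : exists_member_sl2ZetaElement_neron_values_bar) :
    Summit.BirchSwinnertonDyer.BirchSwinnertonDyer.Theses.EdixhovenFibreFiveSeven.TwistDegreeStepOrdinary := by
  intro hnf W _ _ p _ _ hp11 hadd hirr _hres _hall V _ _ _ Wf _ _ _ C hisoV hG hV4 hC
  have hp5 : 5 ≤ p := by omega
  have hp2 : p ≠ 2 := by omega
  have haddV : Addv V p := (X2.addv_iff_of_isIsogenous hisoV).mp hadd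
  refine twistDegreeStep_of_tameTwistL_at hnf W hp11 hadd hirr ?_ V Wf C hisoV hG hV4 hC
  intro W₀ _ _ hiso₀ M _ g hg h7 hng hnm hirr' m _ hcop χ hχ hχ1 hord ϖ r
  have hisoVW₀ : IsIsogenous V W₀ := (hisoV.symm_of_charZero).trans' hiso₀
  refine katoNeronBody_of_sl2NeronValuesBar_of_rangeAt cupLogInjective_and_hasDualExp_of_isDeRham_holds hP1 W₀ p
    ?_ g hg (by omega) hng hnm hirr' m hcop ?_ (Or.inl h7) χ hχ hχ1 hord ϖ r
  · intro v hpv _ _ _ hp' _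
    exact isDeRham_restrictedRationalTateRep_of_isIsogenous hp' hisoVW₀
      (isDeRham_restrictedRationalTateRep_adicCompletion_rat_of_typeGOrd V p hG v hpv hp')
  · intro W' _ _ hiso w hw _ _ _ hL
    -- the member `W′ ∼ W₀ ∼ V` is again additive, (G)-ordinary, with the same `ord_p Δ_min ≤ 4`
    have hisoVW' : IsIsogenous V W' := hisoVW₀.trans' hiso
    have hadd' : Addv W' p := (X2.addv_iff_of_isIsogenous hisoVW').mp haddV
    have hG' : TypeGOrd W' p := hG.of_isIsogenous hp2 haddV hisoVW'
    have hV4' : padicValInt p W'.minimalDiscriminantInt ≤ 4 := by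
      rw [← padicValInt_minimalDiscriminantInt_eq_of_isIsogenous_of_typeGOrd hp5 hisoVW' haddV hG]; exact hV4
    letI := LocalField.adicCompletionPadicAlgebra w.1 p hw
    letI : Algebra (Place.Completion (K := ℚ) (Sum.inr ((primesEquiv (R := 𝓞 ℚ)).symm ⟨p, Fact.out⟩)))
        (w.1.adicCompletion (CyclotomicField m ℚ)) :=
      inferInstanceAs (Algebra (((primesEquiv (R := 𝓞 ℚ)).symm ⟨p, Fact.out⟩).adicCompletion ℚ)
        (w.1.adicCompletion (CyclotomicField m ℚ)))
    exact StarredOptimalManinUnitFiveSevenRecTowerAtBridgeAlt.rangeAt_of_recTowerAtAlt W' p ((primesEquiv (R := 𝓞 ℚ)).symm ⟨p, Fact.out⟩) hL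
      (recTowerOrdinaryUnstarred_of_typeGOrd W' p hp5 hadd' hV4' hG' m (KatoAssemblySocket.not_dvd_of_coprime_mul hcop) w hw hL)

end Summit.BirchSwinnertonDyer.BirchSwinnertonDyer.Theorems.TwistDegreeStepOrdinaryOfSL2NeronValuesBar

end
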